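import Mathlib
import Summits.PneNP.PneNP.Theorems.PositionalGamesMpgHardNpLanguageLasso
import Summits.PneNP.PneNP.Theorems.PositionalGamesMpgHardNpLanguageArith

/-!
# Route PositionalGames — support item `MpgHardNpLanguage` (stmt-PneNP-1300): tables of a game and soundness of the certificate

Theorem file (proof of `Summit.PneNP.PneNP.Theses.PositionalGames.MpgHardNpLanguage`) about the
finite structure `gameTab n o v x` of `…Defs.lean` on the universe `Fin (2n+2)` presenting a
threshold mean-payoff template `(o, v)` of the route with input `x`:

* evaluation of every atom on it (`tab_…` by `rfl`, `isV_iff`, …, `lt_iff`), the values of the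
  two input bit rows (`ofBits_pnRow = 2ⁿ`, `ofBits_w2Row = 2·w(u)` with `wt x u = Σⱼ [x(u,j)]·2ʲ`
  the route's weight), and the translation of the first-order transcript `AddQ` over the
  standard order into the Boolean `AddOK` (`addQ_iff_addOK`);
* SOUNDNESS `mpgWin_of_mpgQ`: if some witness tables pass the check `mpgQ` then Even wins
  (`MpgWin`, verbatim the route's inline predicate): Even's strategy is read off `Q1`; an Odd
  dead end (`Q2`) makes every Odd strategy illegal; otherwise (`Q3`) the merged strategy is a
  choice function of the certified successor relation, the orbit from `v` stays in the guessed
  set, the certified transcripts give `Φ(f u) + 2ⁿ ≤ Φ(u) + 2·w(u)` along the orbit, and the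
  lasso lemma `mul_card_cycle_le_sum` (`…Lasso.lean`) telescopes this around the cycle.

Zwick–Paterson 1996 §2 / folklore; no determinacy is used.
-/

namespace Summit.PneNP.PneNP.Theorems.MpgNP

set_option linter.dupNamespace false -- `Summit.PneNP.PneNP.…`: summit = sub-problem (D-0017)

open Literature.ModelTheory.FiniteModelTheory Literature.Computability.Cryptography
open Literature.Computability.Complexity.ArithCkt Finset Filter

variable {n : ℕ}

/-- `vx` is injective on values. [folklore] -/
@[simp] theorem val_vx (u : Fin n) : ((vx u : Fin (usize n)) : ℕ) = u := rfl

/-- `w(u) < 2ⁿ`. [folklore] -/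
theorem wt_lt (x : (Fin n × Fin n) ⊕ (Fin n × Fin n) → Bool) (u : Fin n) : wt x u < 2 ^ n := by
  rw [wt, ← ofBits_eq_sum_ite (fun j => x (Sum.inr (u, j)))]
  exact Nat.ofBits_lt_two_pow _

section Eval

variable (o : Fin n → Bool) (v : Fin n) (x : (Fin n × Fin n) ⊕ (Fin n × Fin n) → Bool)

/-- Table `IsV`, unfolded. [folklore] -/
theorem tab_isV (a : Fin (usize n)) : gameTab n o v x iIsV ![a] = decide ((a : ℕ) < n) := rfl

/-- Table `Ow`, unfolded. [folklore] -/
theorem tab_ow (a : Fin (usize n)) :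
    gameTab n o v x iOw ![a] = (if h : (a : ℕ) < n then o ⟨a, h⟩ else false) := rfl

/-- Table `St`, unfolded. [folklore] -/
theorem tab_st (a : Fin (usize n)) : gameTab n o v x iSt ![a] = decide ((a : ℕ) = v) := rfl

/-- Table `Ed`, unfolded. [folklore] -/
theorem tab_ed (a b : Fin (usize n)) : gameTab n o v x iEd ![a, b] =
    (if ha : (a : ℕ) < n then (if hb : (b : ℕ) < n then x (Sum.inl (⟨a, ha⟩, ⟨b, hb⟩)) else false)
      else false) := rfl

/-- Table `W2`, unfolded. [folklore] -/
theorem tab_w2 (a j : Fin (usize n)) : gameTab n o v x iW2 ![a, j] =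
    (if ha : (a : ℕ) < n then (if hj : 1 ≤ (j : ℕ) ∧ (j : ℕ) ≤ n then
      x (Sum.inr (⟨a, ha⟩, ⟨(j : ℕ) - 1, by omega⟩)) else false) else false) := rfl

/-- Table `PN`, unfolded. [folklore] -/
theorem tab_pn (j : Fin (usize n)) : gameTab n o v x iPN ![j] = decide ((j : ℕ) = n) := rfl

/-- Table `LT`, unfolded. [folklore] -/
theorem tab_lt (i j : Fin (usize n)) : gameTab n o v x iLT ![i, j] = decide ((i : ℕ) < (j : ℕ)) := rfl

/-- `IsV a ↔ a < n`. [folklore] -/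
theorem isV_iff (a : Fin (usize n)) : isV (gameTab n o v x) a ↔ (a : ℕ) < n := by
  unfold isV; rw [tab_isV, decide_eq_true_iff]

/-- `IsV (vx u)`. [folklore] -/
theorem isV_vx (u : Fin n) : isV (gameTab n o v x) (vx u) := (isV_iff o v x _).2 u.2

/-- A vertex element is `vx` of a vertex. [folklore] -/
theorem exists_eq_vx {a : Fin (usize n)} (ha : (a : ℕ) < n) : ∃ u : Fin n, a = vx u :=
  ⟨⟨a, ha⟩, Fin.ext rfl⟩

/-- `Ow (vx u) ↔ o u`. [folklore] -/
theorem ow_vx_iff (u : Fin n) : ow (gameTab n o v x) (vx u) ↔ o u = true := by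
  unfold ow; rw [tab_ow, dif_pos (by exact u.2)]; rfl

/-- `St a ↔ a = v`. [folklore] -/
theorem st_iff (a : Fin (usize n)) : st (gameTab n o v x) a ↔ (a : ℕ) = v := by
  unfold st; rw [tab_st, decide_eq_true_iff]

/-- `Ed (vx u) (vx w) ↔ x (inl (u, w))`. [folklore] -/
theorem ed_vx_iff (u w : Fin n) : ed (gameTab n o v x) (vx u) (vx w) ↔ x (Sum.inl (u, w)) = true := by
  unfold ed; rw [tab_ed, dif_pos (by exact u.2), dif_pos (by exact w.2)]; rfl

/-- `PN j ↔ j = n`. [folklore] -/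
theorem pn_iff (j : Fin (usize n)) : pn (gameTab n o v x) j ↔ (j : ℕ) = n := by
  unfold pn; rw [tab_pn, decide_eq_true_iff]

/-- `LT i j ↔ i < j`. [folklore] -/
theorem lt_iff (i j : Fin (usize n)) : lt (gameTab n o v x) i j ↔ i < j := by
  unfold lt; rw [tab_lt, decide_eq_true_iff, Fin.lt_def]

/-- `⟦pnRow⟧ = 2ⁿ`. [folklore] -/
theorem ofBits_pnRow (n : ℕ) : Nat.ofBits (pnRow n) = 2 ^ n := by
  have h : pnRow n = natRow (usize n) (2 ^ n) := by
    funext j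
    simp only [pnRow, natRow, Nat.testBit_two_pow]
    by_cases hj : (j : ℕ) = n
    · simp [hj]
    · simp [hj, Ne.symm hj]
  rw [h, ofBits_natRow_of_lt]
  exact Nat.pow_lt_pow_right (by norm_num) (by unfold usize; omega)

/-- The table `W2` at a vertex is the row `w2Row`. [folklore] -/
theorem w2_vx_iff (u : Fin n) (j : Fin (usize n)) : w2 (gameTab n o v x) (vx u) j ↔ w2Row x u j = true := by
  unfold w2; rw [tab_w2, dif_pos (by exact u.2)]; rfl

/-- `⟦w2Row u⟧ = 2·w(u)`. [folklore] -/
theorem ofBits_w2Row (u : Fin n) : Nat.ofBits (w2Row x u) = 2 * wt x u := by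
  have hw : wt x u = Nat.ofBits (fun j : Fin n => x (Sum.inr (u, j))) := by
    rw [wt, ofBits_eq_sum_ite]
  -- digit by digit: bit `0` of `2·w` is `0`, bit `k+1` is bit `k` of `w`
  have key : ∀ (jv : ℕ) (hjv : jv < usize n), w2Row x u ⟨jv, hjv⟩ = (2 * wt x u).testBit jv := by
    intro jv hjv
    rw [hw]
    cases jv with
    | zero =>
      rw [Nat.testBit_zero, Nat.mul_mod_right]
      simp [w2Row]
    | succ k =>
      rw [Nat.testBit_add_one, Nat.mul_div_cancel_left _ (by norm_num : 0 < 2), Nat.testBit_ofBits]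
      by_cases hk : k < n
      · rw [dif_pos hk]
        simp only [w2Row]
        rw [dif_pos (by omega)]
        rfl
      · rw [dif_neg hk]
        simp only [w2Row]
        rw [dif_neg (by omega)]
  have h1 : w2Row x u = natRow (usize n) (2 * wt x u) := funext fun j => key j j.2
  rw [h1, ofBits_natRow_of_lt]
  have := wt_lt x u
  have h2 : 2 ^ (n + 1) ≤ 2 ^ usize n := Nat.pow_le_pow_right (by norm_num) (by unfold usize; omega)
  rw [pow_succ] at h2
  omega

end Eval

/-! ### The first-order transcript over the standard order is `AddOK` -/

section AddBridge

variable (o : Fin n → Bool) (v : Fin n) (x : (Fin n × Fin n) ⊕ (Fin n × Fin n) → Bool)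

/-- Least position = position `0`. [folklore] -/
theorem isMinP_iff (j : Fin (usize n)) : IsMinP (gameTab n o v x) j ↔ (j : ℕ) = 0 := by
  simp only [IsMinP, lt_iff]
  constructor
  · intro h
    by_contra hne
    exact h ⟨0, by unfold usize; omega⟩ (by rw [Fin.lt_def]; show 0 < (j : ℕ); omega)
  · intro h i hi
    rw [Fin.lt_def, h] at hi
    exact Nat.not_lt_zero _ hi

/-- Successor positions. [folklore] -/
theorem coversP_iff (j j' : Fin (usize n)) : CoversP (gameTab n o v x) j j' ↔ (j' : ℕ) = (j : ℕ) + 1 := by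
  simp only [CoversP, lt_iff, Fin.lt_def]
  constructor
  · rintro ⟨h1, h2⟩
    by_contra hne
    exact h2 ⟨(j : ℕ) + 1, by omega⟩ ⟨by simp, by simp; omega⟩
  · intro h
    refine ⟨by omega, fun k ⟨hk1, hk2⟩ => by omega⟩

/-- Greatest position = position `2n + 1`. [folklore] -/
theorem isMaxP_iff (j : Fin (usize n)) : IsMaxP (gameTab n o v x) j ↔ (j : ℕ) + 1 = usize n := by
  simp only [IsMaxP, lt_iff, Fin.lt_def]
  constructor
  · intro h
    by_contra hne
    exact h ⟨(j : ℕ) + 1, by have := j.2; unfold usize at *; omega⟩ (by simp)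
  · intro h k hk
    have := k.2
    omega

/-- **`AddQ` over the game's order is the Boolean transcript predicate `AddOK`.**
[cite: Vollmer1999, §1.1] -/
theorem addQ_iff_addOK (A B S C : Fin (usize n) → Bool) :
    AddQ (gameTab n o v x) (fun j => A j = true) (fun j => B j = true) (fun j => S j = true)
      (fun j => C j = true) ↔ AddOK A B S C := by
  unfold AddQ AddOK
  refine and_congr ?_ (and_congr ?_ (and_congr ?_ ?_))
  · refine forall_congr' fun j => ?_
    rw [isMinP_iff]
    simp
  · refine forall_congr' fun j => ?_
    rw [eq_faSum_iff]
  · refine forall_congr' fun j => forall_congr' fun j' => ?_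
    rw [coversP_iff, eq_faCarry_iff]
    rfl
  · refine forall_congr' fun j => ?_
    rw [isMaxP_iff, faCarry_eq_false_iff]
    rfl

end AddBridge

/-! ### Soundness of the certificate -/

section Sound

variable (o : Fin n → Bool) (v : Fin n) (x : (Fin n × Fin n) ⊕ (Fin n × Fin n) → Bool)

/-- The certified successor relation between two vertices, unfolded on the game's tables.
[folklore] -/
theorem EP_vx_iff (W : RelTables witVocab (usize n)) (u w : Fin n) :
    EP (gameTab n o v x) W (vx u) (vx w) ↔
      (o u = true ∧ sg W (vx u) (vx w) ∧ x (Sum.inl (u, w)) = true) ∨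
        (o u = false ∧ x (Sum.inl (u, w)) = false) := by
  simp only [EP, isV_vx, ow_vx_iff, ed_vx_iff, true_and, Bool.not_eq_true]

/-- The row `W2` of the tables at a vertex is `w2Row`. [folklore] -/
theorem w2_row_vx_eq (u : Fin n) : (fun j => gameTab n o v x iW2 ![vx u, j]) = w2Row x u := by
  funext j
  rw [tab_w2, dif_pos (by exact u.2)]
  rfl

/-- **Soundness of the certificate.** If some witness tables pass the first-order check on the
tables of the game, then Even wins. [cite: ZwickPaterson1996, §2 (potentials / cycle means)] -/
theorem mpgWin_of_mpgQ (W : RelTables witVocab (usize n)) (hW : mpgQ (gameTab n o v x) W) :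
    MpgWin n o v x := by
  classical
  obtain ⟨hQ1, hQ23⟩ := hW
  -- Even's strategy from `Q1`
  have hex : ∀ u : Fin n, ∃ w : Fin n, o u = true → EP (gameTab n o v x) W (vx u) (vx w) := by
    intro u
    by_cases hu : o u = true
    · obtain ⟨b, hb⟩ := hQ1 (vx u) (isV_vx o v x u) ((ow_vx_iff o v x u).2 hu)
      obtain ⟨w, rfl⟩ := exists_eq_vx (n := n) ((isV_iff o v x b).1 hb.2.1)
      exact ⟨w, fun _ => hb⟩
    · exact ⟨u, fun h => absurd h hu⟩
  choose σ hσ using hex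
  refine ⟨σ, fun u hu => ?_, fun τ hτ => ?_⟩
  · rcases (EP_vx_iff o v x W u (σ u)).1 (hσ u hu) with ⟨-, -, h⟩ | ⟨h, -⟩
    · exact h
    · rw [hu] at h; exact absurd h (by decide)
  · -- the merged positional strategy is a choice function of `EP`
    set f : Fin n → Fin n := fun w => if o w = true then σ w else τ w with hf
    have hfE : ∀ u, EP (gameTab n o v x) W (vx u) (vx (f u)) := by
      intro u
      by_cases hu : o u = true
      · have : f u = σ u := by simp [hf, hu]
        rw [this]; exact hσ u hu
      · have hu' : o u = false := by simpa using hu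
        have : f u = τ u := by simp [hf, hu']
        rw [this]
        exact (EP_vx_iff o v x W u (τ u)).2 (Or.inr ⟨hu', hτ u hu'⟩)
    intro C
    have hC : ∀ u, u ∈ C ↔ ∃ᶠ t in atTop, f^[t] v = u := fun u => by
      simp only [C, Finset.mem_filter, Finset.mem_univ, true_and]
    rcases hQ23 with ⟨a, ha, -, hno⟩ | ⟨hst, hadd1, hadd2, hcl⟩
    · -- `Q2`: an Odd dead end — but the merged strategy moves from it
      exfalso
      obtain ⟨u, rfl⟩ := exists_eq_vx (n := n) ((isV_iff o v x a).1 ha)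
      exact hno _ (hfE u)
    · -- `Q3`: the orbit stays in the guessed set …
      have hstep : ∀ t, EP (gameTab n o v x) W (vx (f^[t] v)) (vx (f^[t + 1] v)) := fun t => by
        rw [Function.iterate_succ_apply']; exact hfE _
      have hrr : ∀ t, rr W (vx (f^[t] v)) := by
        intro t
        induction t with
        | zero => exact hst _ ((st_iff o v x _).2 rfl)
        | succ t ih => exact (hcl _ _ ih (hstep t)).1
      -- … and the certified transcripts give the potential inequality along it
      let Φ : Fin n → ℕ := fun u => Nat.ofBits (fun j => W jPh ![vx u, j])
      have hineq : ∀ t, Φ (f^[t + 1] v) + 2 ^ n ≤ Φ (f^[t] v) + 2 * wt x (f^[t] v) := by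
        intro t
        set a : Fin (usize n) := vx (f^[t] v)
        set b : Fin (usize n) := vx (f^[t + 1] v)
        -- `S1 b = Ph b + 2ⁿ`
        have h1 : Nat.ofBits (fun j => W jS1 ![b, j]) = Φ (f^[t + 1] v) + 2 ^ n := by
          have := ((addQ_iff_addOK o v x (fun j => W jPh ![b, j]) (pnRow n)
            (fun j => W jS1 ![b, j]) (fun j => W jC1 ![b, j])).1 (hadd1 b)).ofBits_eq
          rw [this, ofBits_pnRow]
        -- `S2 a = Ph a + 2·w(a)`
        have h2 : Nat.ofBits (fun j => W jS2 ![a, j]) = Φ (f^[t] v) + 2 * wt x (f^[t] v) := by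
          have := ((addQ_iff_addOK o v x (fun j => W jPh ![a, j]) (w2Row x (f^[t] v))
            (fun j => W jS2 ![a, j]) (fun j => W jC2 ![a, j])).1 (by
              have h := hadd2 a
              rw [show (w2 (gameTab n o v x) a) = fun j => w2Row x (f^[t] v) j = true from
                funext fun j => propext (w2_vx_iff o v x _ j)] at h
              exact h)).ofBits_eq
          rw [this, ofBits_w2Row]
        -- `S2 a = S1 b + Dd a b`
        have h3 := ((addQ_iff_addOK o v x (fun j => W jS1 ![b, j]) (fun j => W jDd ![a, b, j])
          (fun j => W jS2 ![a, j]) (fun j => W jC3 ![a, b, j])).1 (hcl a b (hrr t) (hstep t)).2).ofBits_eq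
        rw [h1, h2] at h3
        omega
      have key := mul_card_cycle_le_sum f v Φ (fun u => 2 * wt x u) (2 ^ n) hineq C hC
      rw [← Finset.mul_sum] at key
      exact key

end Sound

end Summit.PneNP.PneNP.Theorems.MpgNP
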